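import Summits.QuantumFields.YangMills.Theorems.LuscherReductionTwistedTraceScalingBOStiffPiDensity
import Summits.QuantumFields.YangMills.Theorems.LuscherReductionTwistedTraceScalingBOStiffCentralWeight
import Summits.QuantumFields.YangMills.Theorems.LuscherReductionTwistedTraceScalingBTRatesAtoms
import Mathlib.MeasureTheory.Measure.Haar.Unique
import HarnessLib

/-!
# (B-ST) atom (B3) «PiDensity» AT THE CENTRAL FIBRE: `π = (1 ± ε)·ρ₀·ν` on the profile support `cS L β` for all large `β`, in set / measure / `∫⁻` / `∫` form,
# and the PARAMETRISATION-FREE bridge `balLebesgue L = κ • μ.map T` for ANY linear parametrisation `T` of the balanced subspace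
# (lane A of S-BASE, crux `TwistedTraceScaling` stmt-QuantumFields-20203, C4-CORE, the (B-ST) pen, hand B; `pub/ym-fleet/ym-luscher-20007-p1/HANDOFF-g21.md` §(B3); hand A PROGRESS 9/10)

`…BOStiffPiDensity.orthoTransverse_sharp` gives `ρ₀ > 0` and, for every `ε > 0`, a radius `r(ε)` with `(1−ε)ρ₀·ν ≤ π ≤ (1+ε)ρ₀·ν` on measurable subsets of `capBalancedSet L ∩ ball 0 r`
(`ν = balLebesgue L`, `π = orthoTransverse L`).  The (B-ST) fibre block lives on `cS L β = {cΘ β ≠ 0} ⊆ {‖linkEmbed x‖ ≤ min (1/40) (β^{-1/2}·btLog β)}` (`cΘ_eq_on_cS`), a ball SHRINKING to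
the vacuum, so for every `ε > 0` the comparison holds on `cS L β` for all large `β`:
* §1 `eventually_cS_subset_ball`, ★★★ `orthoTransverse_sharp_cS` (sets), ★★ `orthoTransverse_restrict_cS_sharp` (measures), `balLebesgue_cS_lt_top`,
  ★★ `lintegral_cS_sharp` (`∫⁻`), ★★ `setIntegral_cS_sharp` (Bochner `∫ x in cS L β, f x ∂·` for bounded measurable `f ≥ 0` — the currency of `spec_S3` / `spec_gap_inputs`);
* §2 ★★ `balLebesgue_eq_smul_map` — for ANY finite-dimensional `V`, ANY additive Haar measure `μ` on `V` and ANY injective linear `T : V → (Edge → ℝ³)` with `range T = balancedSet L`: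
  `balLebesgue L = κ • μ.map T` with `0 < κ < ∞` (uniqueness of Haar measure on the balanced subspace), so every statement above holds verbatim for `μ.map T` with `ρ₀ ↦ κρ₀`
  (★★ `orthoTransverse_sharp_map`): hands A/C may use Euclidean coordinates of `linkEmbed(Bal) ⊂ LinkSpace L` or any basis.
HONEST FRAMING: measure bookkeeping for a stub of a child of the CONDITIONAL route R2b1; (B-ST) OPEN; C4-CORE OPEN; not infinite volume, not a gap, not Clay.  No named facts, no `sorry`.
-/

set_option autoImplicit false

noncomputable section

open MeasureTheory Filter Topology Real
open scoped BigOperators Matrix NNReal ENNReal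
open Literature.MathematicalPhysics.QuantumFieldTheory
open Literature.MathematicalPhysics.QuantumLattice

namespace Summit.QuantumFields.YangMills.Theorems.FemtoTransferGap.TwoLattice.ConstTube

open Summit.QuantumFields.YangMills.Theorems.FemtoTransferGap
open Summit.QuantumFields.YangMills.Theorems.FemtoTransferGap.TwoLattice
open Summit.QuantumFields.YangMills.Theorems.FemtoTransferGap.TwoLattice.SlowChart

variable (L : ℕ) [NeZero L]

/-! ## §1 The comparison on the shrinking support `cS L β` -/

/-- The profile support shrinks to the vacuum: for every `r > 0`, eventually `cS L β ⊆ {x | ‖linkEmbed L x‖ < r}`. [folklore] -/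
theorem eventually_cS_subset_ball {r : ℝ} (hr : 0 < r) : ∀ᶠ β : ℝ in atTop, cS L β ⊆ {x | ‖linkEmbed L x‖ < r} := by
  have ht : Tendsto (fun β : ℝ => powScale (1 / 2) β * btLog β) atTop (𝓝 0) := by
    simpa [pow_one] using tendsto_powScale_mul_btLog_pow (show (0 : ℝ) < 1 / 2 by norm_num) 1
  filter_upwards [ht.eventually (gt_mem_nhds hr)] with β hβ x hx
  exact ((cΘ_eq_on_cS (L := L) β hx).2.trans (min_le_right _ _)).trans_lt hβ

/-- ★★★ **SHARP «PiDensity» ON THE PROFILE SUPPORT**: there is `ρ₀ > 0` such that for every `ε > 0`, for all large `β`, every measurable `A ⊆ cS L β` satisfies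
`(1−ε)ρ₀·balLebesgue L A ≤ orthoTransverse L A ≤ (1+ε)ρ₀·balLebesgue L A`. [cite: Luscher1983, §3] -/
theorem orthoTransverse_sharp_cS :
    ∃ ρ₀ : ℝ, 0 < ρ₀ ∧ ∀ ε : ℝ, 0 < ε → ∀ᶠ β : ℝ in atTop, ∀ A : Set (Edge 3 L → Fin 3 → ℝ), MeasurableSet A → A ⊆ cS L β →
      ENNReal.ofReal ((1 - ε) * ρ₀) * balLebesgue L A ≤ orthoTransverse L A ∧ orthoTransverse L A ≤ ENNReal.ofReal ((1 + ε) * ρ₀) * balLebesgue L A := by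
  obtain ⟨ρ₀, hρ₀, h⟩ := orthoTransverse_sharp_linkEmbed L
  refine ⟨ρ₀, hρ₀, fun ε hε => ?_⟩
  obtain ⟨r, hr, h⟩ := h ε hε
  filter_upwards [eventually_cS_subset_ball L hr] with β hβ A hA hAS
  exact h A hA (fun x hx => mem_capBalancedSet_of_mem_cS (L := L) β (hAS hx)) (hAS.trans hβ)

/-- ★★ **MEASURE FORM on the support**: for all large `β`, `(1−ε)ρ₀·ν|_{cS β} ≤ π|_{cS β} ≤ (1+ε)ρ₀·ν|_{cS β}`. [folklore] -/
theorem orthoTransverse_restrict_cS_sharp :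
    ∃ ρ₀ : ℝ, 0 < ρ₀ ∧ ∀ ε : ℝ, 0 < ε → ∀ᶠ β : ℝ in atTop,
      ENNReal.ofReal ((1 - ε) * ρ₀) • (balLebesgue L).restrict (cS L β) ≤ (orthoTransverse L).restrict (cS L β) ∧
      (orthoTransverse L).restrict (cS L β) ≤ ENNReal.ofReal ((1 + ε) * ρ₀) • (balLebesgue L).restrict (cS L β) := by
  obtain ⟨ρ₀, hρ₀, h⟩ := orthoTransverse_sharp_cS L
  refine ⟨ρ₀, hρ₀, fun ε hε => ?_⟩
  filter_upwards [h ε hε] with β hβ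
  refine ⟨Measure.le_iff.2 fun A hA => ?_, Measure.le_iff.2 fun A hA => ?_⟩
  · rw [Measure.restrict_apply hA, Measure.smul_apply, Measure.restrict_apply hA, smul_eq_mul]
    exact (hβ (A ∩ cS L β) (hA.inter (measurableSet_cS (L := L) β)) Set.inter_subset_right).1
  · rw [Measure.restrict_apply hA, Measure.smul_apply, Measure.restrict_apply hA, smul_eq_mul]
    exact (hβ (A ∩ cS L β) (hA.inter (measurableSet_cS (L := L) β)) Set.inter_subset_right).2

/-- The flat measure of the support is finite for all large `β` (from the LOWER density bound and `π ≤ 1`). [folklore] -/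
theorem balLebesgue_cS_lt_top : ∀ᶠ β : ℝ in atTop, balLebesgue L (cS L β) < ⊤ := by
  obtain ⟨ρ₀, hρ₀, h⟩ := orthoTransverse_sharp_cS L
  filter_upwards [h (1 / 2) (by norm_num)] with β hβ
  have h1 := (hβ (cS L β) (measurableSet_cS (L := L) β) le_rfl).1
  have hc : ENNReal.ofReal ((1 - 1 / 2) * ρ₀) ≠ 0 := (ENNReal.ofReal_pos.2 (by positivity)).ne'
  haveI := isFiniteMeasure_orthoTransverse L
  have hfin : orthoTransverse L (cS L β) < ⊤ := measure_lt_top _ _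
  by_contra htop
  rw [not_lt, top_le_iff] at htop
  rw [htop, ENNReal.mul_top hc] at h1
  exact (lt_irrefl _) (hfin.trans_le h1)

/-- ★★ **`∫⁻` FORM on the support**: for all large `β` and every measurable `f ≥ 0`,
`(1−ε)ρ₀·∫⁻_{cS} f dν ≤ ∫⁻_{cS} f dπ ≤ (1+ε)ρ₀·∫⁻_{cS} f dν`. [folklore] -/
theorem lintegral_cS_sharp :
    ∃ ρ₀ : ℝ, 0 < ρ₀ ∧ ∀ ε : ℝ, 0 < ε → ∀ᶠ β : ℝ in atTop, ∀ f : (Edge 3 L → Fin 3 → ℝ) → ℝ≥0∞,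
      ENNReal.ofReal ((1 - ε) * ρ₀) * ∫⁻ x in cS L β, f x ∂balLebesgue L ≤ ∫⁻ x in cS L β, f x ∂orthoTransverse L ∧
        ∫⁻ x in cS L β, f x ∂orthoTransverse L ≤ ENNReal.ofReal ((1 + ε) * ρ₀) * ∫⁻ x in cS L β, f x ∂balLebesgue L := by
  obtain ⟨ρ₀, hρ₀, h⟩ := orthoTransverse_restrict_cS_sharp L
  refine ⟨ρ₀, hρ₀, fun ε hε => ?_⟩
  filter_upwards [h ε hε] with β ⟨hlo, hup⟩ f
  constructor
  · calc ENNReal.ofReal ((1 - ε) * ρ₀) * ∫⁻ x in cS L β, f x ∂balLebesgue L = ∫⁻ x, f x ∂(ENNReal.ofReal ((1 - ε) * ρ₀) • (balLebesgue L).restrict (cS L β)) := by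
          rw [lintegral_smul_measure, smul_eq_mul]
      _ ≤ ∫⁻ x, f x ∂(orthoTransverse L).restrict (cS L β) := lintegral_mono' hlo le_rfl
  · calc ∫⁻ x in cS L β, f x ∂orthoTransverse L ≤ ∫⁻ x, f x ∂(ENNReal.ofReal ((1 + ε) * ρ₀) • (balLebesgue L).restrict (cS L β)) := lintegral_mono' hup le_rfl
      _ = ENNReal.ofReal ((1 + ε) * ρ₀) * ∫⁻ x in cS L β, f x ∂balLebesgue L := by rw [lintegral_smul_measure, smul_eq_mul]

/-- ★★ **`∫` FORM on the support** (the currency of `spec_S3` / `spec_gap_inputs`): for all large `β` and every bounded measurable `f ≥ 0`,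
`(1−ε)ρ₀·∫_{cS} f dν ≤ ∫_{cS} f dπ ≤ (1+ε)ρ₀·∫_{cS} f dν` (Bochner integrals; `0 < ε < 1`). [folklore] -/
theorem setIntegral_cS_sharp :
    ∃ ρ₀ : ℝ, 0 < ρ₀ ∧ ∀ ε : ℝ, 0 < ε → ε < 1 → ∀ᶠ β : ℝ in atTop, ∀ f : (Edge 3 L → Fin 3 → ℝ) → ℝ, Measurable f → (∀ x, 0 ≤ f x) → (∃ C : ℝ, ∀ x, f x ≤ C) →
      (1 - ε) * ρ₀ * ∫ x in cS L β, f x ∂balLebesgue L ≤ ∫ x in cS L β, f x ∂orthoTransverse L ∧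
        ∫ x in cS L β, f x ∂orthoTransverse L ≤ (1 + ε) * ρ₀ * ∫ x in cS L β, f x ∂balLebesgue L := by
  obtain ⟨ρ₀, hρ₀, h⟩ := orthoTransverse_restrict_cS_sharp L
  refine ⟨ρ₀, hρ₀, fun ε hε hε1 => ?_⟩
  haveI := isFiniteMeasure_orthoTransverse L
  filter_upwards [h ε hε, balLebesgue_cS_lt_top L] with β ⟨hlo, hup⟩ hfin f hf hf0 ⟨C, hC⟩
  haveI : IsFiniteMeasure ((balLebesgue L).restrict (cS L β)) := ⟨by rw [Measure.restrict_apply_univ]; exact hfin⟩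
  have hbdd : ∀ x, ‖f x‖ ≤ max C 0 := fun x => by rw [Real.norm_eq_abs, abs_of_nonneg (hf0 x)]; exact (hC x).trans (le_max_left _ _)
  have hint : ∀ (μ : Measure (Edge 3 L → Fin 3 → ℝ)) [IsFiniteMeasure μ], Integrable f μ := fun μ _ =>
    Integrable.of_bound hf.aestronglyMeasurable (max C 0) (ae_of_all _ hbdd)
  have h1 : (1 - ε) * ρ₀ = (ENNReal.ofReal ((1 - ε) * ρ₀)).toReal := (ENNReal.toReal_ofReal (by nlinarith)).symm
  have h2 : (1 + ε) * ρ₀ = (ENNReal.ofReal ((1 + ε) * ρ₀)).toReal := (ENNReal.toReal_ofReal (by positivity)).symm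
  constructor
  · rw [h1, ← smul_eq_mul, ← integral_smul_measure]
    exact integral_mono_measure hlo (ae_of_all _ hf0) (hint _)
  · rw [h2, ← smul_eq_mul, ← integral_smul_measure]
    exact integral_mono_measure hup (ae_of_all _ hf0) ((hint _).smul_measure ENNReal.ofReal_ne_top)

/-! ## §2 Parametrisation-free: any linear parametrisation of the balanced subspace, any Haar measure -/

section Param

variable {V : Type*} [NormedAddCommGroup V] [NormedSpace ℝ V] [FiniteDimensional ℝ V] [MeasurableSpace V] [BorelSpace V]
  (μ : Measure V) [μ.IsAddHaarMeasure] {T : V →ₗ[ℝ] (Edge 3 L → Fin 3 → ℝ)}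

/-- ★★ **UNIQUENESS OF THE FLAT MEASURE ON THE BALANCED SUBSPACE**: for any finite-dimensional `V`, any additive Haar measure `μ` on `V`, and any injective linear
`T : V → (Edge → ℝ³)` whose range is the balanced subspace, `balLebesgue L = κ • μ.map T` with `0 < κ < ∞` (the off-base parametrisation `balExt L` and `T` differ by a
linear automorphism of `V`; Haar measure is unique up to a constant). [folklore] -/
theorem balLebesgue_eq_smul_map (hT : Function.Injective T) (hrange : Set.range T = balancedSet L) :
    ∃ κ : ℝ≥0, 0 < κ ∧ balLebesgue L = (κ : ℝ≥0∞) • μ.map T := by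
  -- the linear automorphism `Ψ : W ≃ V` with `T ∘ Ψ = balExt L`
  have hmem : ∀ w : {e : Edge 3 L // ¬e.1 = 0} → Fin 3 → ℝ, (balExt L w : Edge 3 L → Fin 3 → ℝ) ∈ LinearMap.range T := fun w => by
    rw [LinearMap.mem_range, ← Set.mem_range, hrange]; exact balExt_mem_balancedSet L w
  set Ψ₀ : ({e : Edge 3 L // ¬e.1 = 0} → Fin 3 → ℝ) →ₗ[ℝ] V :=
    (LinearEquiv.ofInjective T hT).symm.toLinearMap ∘ₗ ((balExt L : ({e : Edge 3 L // ¬e.1 = 0} → Fin 3 → ℝ) →ₗ[ℝ] (Edge 3 L → Fin 3 → ℝ)).codRestrict (LinearMap.range T) hmem)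
    with hΨ₀
  have hTΨ : ∀ w, T (Ψ₀ w) = balExt L w := fun w => by
    have h2 : (LinearEquiv.ofInjective T hT) (Ψ₀ w) = ⟨balExt L w, hmem w⟩ := by
      rw [hΨ₀, LinearMap.comp_apply]; exact (LinearEquiv.ofInjective T hT).apply_symm_apply _
    have h3 := congrArg Subtype.val h2
    rwa [LinearEquiv.ofInjective_apply] at h3
  have hΨinj : Function.Injective Ψ₀ := fun w w' h => balExt_injective L (by rw [← hTΨ, ← hTΨ, h])
  have hΨsurj : Function.Surjective Ψ₀ := fun v => by
    have hv : T v ∈ balancedSet L := by rw [← hrange]; exact Set.mem_range_self v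
    refine ⟨fun e' => T v e'.1, hT ?_⟩
    rw [hTΨ, balExt_restrict_eq_self L hv]
  set Ψ : ({e : Edge 3 L // ¬e.1 = 0} → Fin 3 → ℝ) ≃ₗ[ℝ] V := LinearEquiv.ofBijective Ψ₀ ⟨hΨinj, hΨsurj⟩ with hΨ
  -- `vol.map Ψ` is a Haar measure on `V`, hence a multiple of `μ`
  haveI : ((volume : Measure ({e : Edge 3 L // ¬e.1 = 0} → Fin 3 → ℝ)).map Ψ).IsAddHaarMeasure := Measure.MapLinearEquiv.isAddHaarMeasure _ Ψ
  set κ : ℝ≥0 := ((volume : Measure ({e : Edge 3 L // ¬e.1 = 0} → Fin 3 → ℝ)).map Ψ).addHaarScalarFactor μ with hκ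
  have hκμ : (volume : Measure ({e : Edge 3 L // ¬e.1 = 0} → Fin 3 → ℝ)).map Ψ = κ • μ := Measure.isAddLeftInvariant_eq_smul _ _
  refine ⟨κ, Measure.addHaarScalarFactor_pos_of_isAddHaarMeasure _ _, ?_⟩
  have hTm : Measurable (T : V → Edge 3 L → Fin 3 → ℝ) := (LinearMap.continuous_of_finiteDimensional T).measurable
  have hcomp : (balExt L : ({e : Edge 3 L // ¬e.1 = 0} → Fin 3 → ℝ) → (Edge 3 L → Fin 3 → ℝ)) = (T : V → Edge 3 L → Fin 3 → ℝ) ∘ Ψ := by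
    funext w; exact (hTΨ w).symm
  have hΨm : Measurable (Ψ : ({e : Edge 3 L // ¬e.1 = 0} → Fin 3 → ℝ) → V) := by
    exact (LinearMap.continuous_of_finiteDimensional (Ψ : ({e : Edge 3 L // ¬e.1 = 0} → Fin 3 → ℝ) →ₗ[ℝ] V)).measurable
  rw [balLebesgue, hcomp, ← Measure.map_map hTm hΨm]
  change ((volume : Measure ({e : Edge 3 L // ¬e.1 = 0} → Fin 3 → ℝ)).map Ψ).map T = _
  rw [hκμ, Measure.map_smul, ENNReal.smul_def]

omit [μ.IsAddHaarMeasure] in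
/-- The push-forward measure of an image: `(μ.map T)(T '' A) = μ A` for injective linear `T` (any set `A`; `T` is a measurable embedding). [folklore] -/
theorem map_apply_image_of_injective (hT : Function.Injective T) (A : Set V) : (μ.map T) (T '' A) = μ A := by
  have hemb : MeasurableEmbedding (T : V → Edge 3 L → Fin 3 → ℝ) :=
    (LinearMap.isClosedEmbedding_of_injective (f := T) (LinearMap.ker_eq_bot.2 hT)).measurableEmbedding
  rw [hemb.map_apply, Set.preimage_image_eq _ hT]

/-- ★★ **SHARP «PiDensity» for ANY flat parametrisation**: with `T`, `μ` as above there is `ρ_T > 0` such that for every `ε > 0` some `r > 0` gives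
`(1−ε)ρ_T·(μ.map T) A ≤ orthoTransverse L A ≤ (1+ε)ρ_T·(μ.map T) A` for measurable `A ⊆ capBalancedSet L ∩ ball 0 r` — e.g. `(μ.map T)(T '' A') = μ A'`. [folklore] -/
theorem orthoTransverse_sharp_map (hT : Function.Injective T) (hrange : Set.range T = balancedSet L) :
    ∃ ρ₀ : ℝ, 0 < ρ₀ ∧ ∀ ε : ℝ, 0 < ε → ∃ r : ℝ, 0 < r ∧ ∀ A : Set (Edge 3 L → Fin 3 → ℝ), MeasurableSet A → A ⊆ capBalancedSet L → A ⊆ Metric.ball 0 r →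
      ENNReal.ofReal ((1 - ε) * ρ₀) * (μ.map T) A ≤ orthoTransverse L A ∧ orthoTransverse L A ≤ ENNReal.ofReal ((1 + ε) * ρ₀) * (μ.map T) A := by
  obtain ⟨κ, hκ, hν⟩ := balLebesgue_eq_smul_map L μ hT hrange
  obtain ⟨ρ₀, hρ₀, h⟩ := orthoTransverse_sharp L
  refine ⟨κ * ρ₀, by positivity, fun ε hε => ?_⟩
  obtain ⟨r, hr, h⟩ := h ε hε
  refine ⟨r, hr, fun A hA hAc hAb => ?_⟩
  obtain ⟨h1, h2⟩ := h A hA hAc hAb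
  rw [hν, Measure.smul_apply, smul_eq_mul, ← mul_assoc] at h1 h2
  have hk : ∀ t : ℝ, ENNReal.ofReal (t * ρ₀) * (κ : ℝ≥0∞) = ENNReal.ofReal (t * (κ * ρ₀)) := fun t => by
    rw [ENNReal.ofReal, ENNReal.ofReal, ← ENNReal.coe_mul, ENNReal.coe_inj]
    by_cases ht : 0 ≤ t * ρ₀
    · rw [show t * (κ * ρ₀) = (t * ρ₀) * κ by ring, Real.toNNReal_mul ht, Real.toNNReal_coe]
    · have ht' : t * ρ₀ ≤ 0 := le_of_not_ge ht
      have ht'' : t * (κ * ρ₀) ≤ 0 := by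
        rw [show t * (κ * ρ₀) = (t * ρ₀) * κ by ring]; exact mul_nonpos_of_nonpos_of_nonneg ht' κ.2
      rw [Real.toNNReal_of_nonpos ht', Real.toNNReal_of_nonpos ht'', zero_mul]
  rw [hk] at h1 h2
  exact ⟨h1, h2⟩

end Param

end Summit.QuantumFields.YangMills.Theorems.FemtoTransferGap.TwoLattice.ConstTube

end
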